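import Summits.CriticalPhenomena.PercolationContinuityZ3.Theorems.PercNearOneGluingNoHeavyLowerTailFrontierDecRowsEdgeInduction
import HarnessLib

/-!
# The halving lemma (v) along one pair: the CROSS INEQUALITY (XI) and the edge-induction schema (Sahi programme, prover prim-sahi-p2 gen 45)

Support file (`--supports stmt-CriticalPhenomena-4575`, helper).  No definitions, no named facts, no sorries; standard axioms.
Memo `run/shared/lean/prim/prim-sahi/FROM-prim-sahi-p2-gen45-PARALLEL-CLOSURE.md` (ADDENDUM A); `prim-sahi-p2/PROOF-E3.md` §55.

SETTING.  `P = prodBernoulli w` on `Fin n`, vertices `s a c`, `U = {s↔a} ∪ {c↔a}`, `D = {s↮c}`, `X = U ∩ D`, and the slack of the halving lemma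
`F(P) := 2·P(X) − P(U)·P(D)` ((v) is `F ≥ 0`; open in general).  Fix a pair `e`, `p = w e`, `μ = P_{w[e↦0]}` (`e` deleted), `ν = P_{w[e↦1]}`
(`e` contracted).  Since every probability is affine in `p` (`stub_oneBondDecomp_k15`) and `F` is quadratic,

  `F(P_w) = (1−p)²·F(μ) + p²·F(ν) + p(1−p)·S_e`,   `S_e := 2μ(X) + 2ν(X) − μ(U)ν(D) − ν(U)μ(D)`     (`halving_pencil_identity`)

— the two-copy expansion of `F` over the two coins of `e` (same state in both copies: the minors; opposite states: the CROSS TERM `S_e`).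
Equivalently `S_e = F(μ) + F(ν) − I_U(e)·I_D(e)` with the influences `I_U = ν(U) − μ(U) ≥ 0`, `I_D = μ(D) − ν(D) ≥ 0` (`cross_eq_sum_sub_infl`):
`F` lies BELOW its chord along every pair by `p(1−p)·I_U I_D` (no single-pair chord induction for (v) — gens 43/44), and (v) holds on the whole
pencil of `e` iff it holds at the two ends and `I_U I_D ≤ (√F(μ) + √F(ν))²`.

* **`halvingUD_of_cross`** [this work] — THE SCHEMA: if the cross inequality `(XI)  μ(U)ν(D) + ν(U)μ(D) ≤ 2μ(X) + 2ν(X)` holds for every weight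
  function and every fractional pair, then (v) `P(U)P(D) ≤ 2P(X)` holds on every finite weighted graph (induction on the number of fractional pairs;
  a `{0,1}`-valued weight is a point mass, where (v) is `1_U·1_D ≤ 2·1_{U∩D}`, `halvingUD_of_zeroOne`).
STATUS of (XI) (memo ADD. A; nothing here asserts it).  In the p = ½ complementary coupling (XI) for `(G, e)` is the fibre count `bad ≤ 2·good`
summed over the fibres in which `e` is mixed, so `(v½ᶜ) ⟹ (XI) ⟹ (v)`; the k-fold cross terms interpolate between the law-level (v) (k = 0) and
the full fibre statement (k = all pairs).  Numerically (adversarial, n ≤ 8, all pair classes, and under parallel amplification):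
0 violations of (XI) in 38 142 (graph, pair) instances (kit j332507/509/532/533); the infimum of `2(μ(X)+ν(X))/(μ(U)ν(D)+ν(U)μ(D))` seen is
`1.59998…` (slightly below the path value `8/5`, `e = sa`, `w(ac) = ½`; a 7-vertex path-plus-bypass graph, exact recheck), so (XI) has a large margin but
its sharp constant is not settled (memo ADD. D).  For a terminal–terminal pair (XI) is elementary: `e = sc` gives
`ν(U) = μ(U)`, `ν(D) = ν(X) = 0`, so (XI) is (v) for `μ`; `e = as` reduces to `I_s + 2I_c + I_aI_c ≥ 3q` in isolation coordinates.
-/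

noncomputable section

namespace Summit.CriticalPhenomena.PercolationContinuityZ3.Theorems

namespace HalvingCross

open MeasureTheory Literature.Probability.Percolation Literature.Probability.LatticeModels EdgeInduction
open scoped Classical

variable {n : ℕ}

/-- **The one-pair identity for the halving slack.**  With `U = {s↔a} ∪ {c↔a}`, `D = {s↮c}`, `X = U ∩ D`, `p = w e`, `μ = P_{w[e↦0]}`, `ν = P_{w[e↦1]}`:
`2P(X) − P(U)P(D) = (1−p)²(2μ(X) − μ(U)μ(D)) + p²(2ν(X) − ν(U)ν(D)) + p(1−p)(2μ(X) + 2ν(X) − μ(U)ν(D) − ν(U)μ(D))`.  Pure algebra over the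
affine pencil. [this work] -/
theorem halving_pencil_identity (w : Sym2 (Fin n) → unitInterval) (e : Sym2 (Fin n)) (s a c : Fin n) :
    let μ := prodBernoulli (Function.update w e 0)
    let ν := prodBernoulli (Function.update w e 1)
    2 * (prodBernoulli w).real ((openConn s a ∪ openConn c a) ∩ (openConn s c)ᶜ) -
        (prodBernoulli w).real (openConn s a ∪ openConn c a) * (prodBernoulli w).real ((openConn s c)ᶜ) =
      (1 - (w e : ℝ)) ^ 2 * (2 * μ.real ((openConn s a ∪ openConn c a) ∩ (openConn s c)ᶜ) -
          μ.real (openConn s a ∪ openConn c a) * μ.real ((openConn s c)ᶜ)) +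
      (w e : ℝ) ^ 2 * (2 * ν.real ((openConn s a ∪ openConn c a) ∩ (openConn s c)ᶜ) -
          ν.real (openConn s a ∪ openConn c a) * ν.real ((openConn s c)ᶜ)) +
      (w e : ℝ) * (1 - (w e : ℝ)) * (2 * μ.real ((openConn s a ∪ openConn c a) ∩ (openConn s c)ᶜ) +
          2 * ν.real ((openConn s a ∪ openConn c a) ∩ (openConn s c)ᶜ) -
          μ.real (openConn s a ∪ openConn c a) * ν.real ((openConn s c)ᶜ) -
          ν.real (openConn s a ∪ openConn c a) * μ.real ((openConn s c)ᶜ)) := by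
  intro μ ν
  rw [stub_oneBondDecomp_k15 n w e ((openConn s a ∪ openConn c a) ∩ (openConn s c)ᶜ),
    stub_oneBondDecomp_k15 n w e (openConn s a ∪ openConn c a), stub_oneBondDecomp_k15 n w e ((openConn s c)ᶜ)]
  ring

/-- **The cross term is the endpoint slacks minus the product of the influences**:
`2μ(X) + 2ν(X) − μ(U)ν(D) − ν(U)μ(D) = (2μ(X) − μ(U)μ(D)) + (2ν(X) − ν(U)ν(D)) − (ν(U) − μ(U))(μ(D) − ν(D))` (any reals). [this work] -/
theorem cross_eq_sum_sub_infl (x0 x1 u0 u1 d0 d1 : ℝ) :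
    2 * x0 + 2 * x1 - u0 * d1 - u1 * d0 = (2 * x0 - u0 * d0) + (2 * x1 - u1 * d1) - (u1 - u0) * (d0 - d1) := by ring

/-- **The whole pencil from its ends and the cross term**: if `F₀, F₁ ≥ 0` and the cross term `S ≥ 0` then `(1−p)²F₀ + p²F₁ + p(1−p)S ≥ 0`
for `p ∈ [0,1]`. [this work] -/
theorem pencil_nonneg {p F0 F1 S : ℝ} (hp0 : 0 ≤ p) (hp1 : p ≤ 1) (h0 : 0 ≤ F0) (h1 : 0 ≤ F1) (hS : 0 ≤ S) :
    0 ≤ (1 - p) ^ 2 * F0 + p ^ 2 * F1 + p * (1 - p) * S := by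
  have : 0 ≤ 1 - p := sub_nonneg.2 hp1
  positivity

/-- **Base case**: for a `{0,1}`-valued weight function `prodBernoulli w` is a point mass and (v) reads `1_U·1_D ≤ 2·1_{U ∩ D}`. [this work] -/
theorem halvingUD_of_zeroOne (w : Sym2 (Fin n) → unitInterval) (hw : ∀ e, w e = 0 ∨ w e = 1) (s a c : Fin n) :
    (prodBernoulli w).real (openConn s a ∪ openConn c a) * (prodBernoulli w).real ((openConn s c)ᶜ) ≤
      2 * (prodBernoulli w).real ((openConn s a ∪ openConn c a) ∩ (openConn s c)ᶜ) := by
  rw [real_eq_ite_of_zeroOne w hw (openConn s a ∪ openConn c a), real_eq_ite_of_zeroOne w hw ((openConn s c)ᶜ),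
    real_eq_ite_of_zeroOne w hw ((openConn s a ∪ openConn c a) ∩ (openConn s c)ᶜ)]
  simp only [Set.mem_inter_iff]
  by_cases hU : {e | w e = 1} ∈ (openConn s a ∪ openConn c a : Set (BondConfig (Fin n))) <;>
    by_cases hD : {e | w e = 1} ∈ ((openConn s c)ᶜ : Set (BondConfig (Fin n))) <;> norm_num [hU, hD]

/-- **THE EDGE-INDUCTION SCHEMA FOR THE HALVING LEMMA.**  If the cross inequality
`(XI)  μ(U)·ν(D) + ν(U)·μ(D) ≤ 2μ(X) + 2ν(X)`  (`μ = P_{w[e↦0]}`, `ν = P_{w[e↦1]}`, `U = {s↔a} ∪ {c↔a}`, `D = {s↮c}`, `X = U ∩ D`)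
holds for every weight function `w` and every pair `e` with `0 < w e < 1`, then the halving lemma (v) `P(U)·P(D) ≤ 2·P(U ∩ D)` holds under
`prodBernoulli w` for EVERY `w`.  ((XI) is implied by the fibre conjecture `bad ≤ 2·good`; numerically it holds with a margin ≈ 1.6; nothing here asserts it.) [this work] -/
theorem halvingUD_of_cross (s a c : Fin n)
    (h : ∀ (w : Sym2 (Fin n) → unitInterval) (e : Sym2 (Fin n)), e ∈ fracEdges w →
      (prodBernoulli (Function.update w e 0)).real (openConn s a ∪ openConn c a) *
          (prodBernoulli (Function.update w e 1)).real ((openConn s c)ᶜ) +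
        (prodBernoulli (Function.update w e 1)).real (openConn s a ∪ openConn c a) *
          (prodBernoulli (Function.update w e 0)).real ((openConn s c)ᶜ) ≤
      2 * (prodBernoulli (Function.update w e 0)).real ((openConn s a ∪ openConn c a) ∩ (openConn s c)ᶜ) +
        2 * (prodBernoulli (Function.update w e 1)).real ((openConn s a ∪ openConn c a) ∩ (openConn s c)ᶜ)) :
    ∀ w : Sym2 (Fin n) → unitInterval,
      (prodBernoulli w).real (openConn s a ∪ openConn c a) * (prodBernoulli w).real ((openConn s c)ᶜ) ≤
        2 * (prodBernoulli w).real ((openConn s a ∪ openConn c a) ∩ (openConn s c)ᶜ) := by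
  -- induction on the number of fractional pairs
  suffices H : ∀ (k : ℕ) (w : Sym2 (Fin n) → unitInterval), (fracEdges w).card ≤ k →
      (prodBernoulli w).real (openConn s a ∪ openConn c a) * (prodBernoulli w).real ((openConn s c)ᶜ) ≤
        2 * (prodBernoulli w).real ((openConn s a ∪ openConn c a) ∩ (openConn s c)ᶜ) from
    fun w => H _ w le_rfl
  intro k
  induction k with
  | zero =>
      intro w hk
      have hw : ∀ e, w e = 0 ∨ w e = 1 := fun e =>
        eq_zero_or_one_of_not_mem_fracEdges (by
          intro he
          have : 0 < (fracEdges w).card := Finset.card_pos.2 ⟨e, he⟩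
          omega)
      exact halvingUD_of_zeroOne w hw s a c
  | succ k ih =>
      intro w hk
      by_cases hempty : fracEdges w = ∅
      · have hw : ∀ e, w e = 0 ∨ w e = 1 := fun e => eq_zero_or_one_of_not_mem_fracEdges (by rw [hempty]; simp)
        exact halvingUD_of_zeroOne w hw s a c
      · obtain ⟨e, he⟩ := Finset.nonempty_iff_ne_empty.2 hempty
        have hcard0 : (fracEdges (Function.update w e 0)).card ≤ k := by
          have h1 := Finset.card_le_card (fracEdges_update_subset w e 0 (Or.inl rfl))
          rw [Finset.card_erase_of_mem he] at h1
          omega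
        have hcard1 : (fracEdges (Function.update w e 1)).card ≤ k := by
          have h1 := Finset.card_le_card (fracEdges_update_subset w e 1 (Or.inr rfl))
          rw [Finset.card_erase_of_mem he] at h1
          omega
        have i0 := ih _ hcard0
        have i1 := ih _ hcard1
        have hX := h w e he
        have hp0 : (0 : ℝ) ≤ w e := (w e).2.1
        have hp1 : (w e : ℝ) ≤ 1 := (w e).2.2
        have hid := halving_pencil_identity w e s a c
        simp only at hid
        have key := pencil_nonneg hp0 hp1 (sub_nonneg.2 i0) (sub_nonneg.2 i1) (by linarith [hX] :
          (0 : ℝ) ≤ 2 * (prodBernoulli (Function.update w e 0)).real ((openConn s a ∪ openConn c a) ∩ (openConn s c)ᶜ) +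
            2 * (prodBernoulli (Function.update w e 1)).real ((openConn s a ∪ openConn c a) ∩ (openConn s c)ᶜ) -
            (prodBernoulli (Function.update w e 0)).real (openConn s a ∪ openConn c a) *
              (prodBernoulli (Function.update w e 1)).real ((openConn s c)ᶜ) -
            (prodBernoulli (Function.update w e 1)).real (openConn s a ∪ openConn c a) *
              (prodBernoulli (Function.update w e 0)).real ((openConn s c)ᶜ))
        linarith [hid, key]

end HalvingCross

end Summit.CriticalPhenomena.PercolationContinuityZ3.Theorems

end
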